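import Literature.NumberTheory.Sieve.SelbergSymmetryFormula
import HarnessLib

/-!
# Bombieri's asymptotic sieve: [FriedlanderIwaniecPisa1978] Lemma 3 for `K = ℚ`, proved

Topic `Literature/NumberTheory/Sieve`, companion ("Proofs") file of `BombieriAsymptoticSieve.lean`.
Source: J. Friedlander, H. Iwaniec, *On Bombieri's asymptotic sieve*, Ann. Scuola Norm. Sup. Pisa
Cl. Sci. (4) **5** (1978) 719–756 [FriedlanderIwaniecPisa1978], §2, Lemma 3 (p. 727): "There exists
a constant `c > 0`, depending only on the field `K`, such that
(A) `∑_{m ≤ x} μ²(m) b(m) Λ_{(k)}(m) > γ_{(k)} x (log x)^{|k|−1} − c^{|k|} x (log xc)^{|k|−2}`,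
(B) `∑_{m ≤ x} b₂(m) Λ_{(k)}(m) < γ_{(k)} x (log x)^{|k|−1} + c^{|k|} x (log xc)^{|k|−2}`."
Here `K = ℚ` (`b = b₂ = 1`), scalar `k ≥ 2` (`γ_k = k`), in the two-sided form vendored as the named
fact `Literature.NumberTheory.Sieve.FI1978_lemma3_rat`:

* `FI1978_lemma3_rat_explicit` — **PROVED**: with `c = e⁶`, for all `k ≥ 2`, `x ≥ 1`,
  `|∑_{m ≤ x} Λ_k(m) − k x (log x)^{k−1}| ≤ c^k x (log cx)^{k−2}`.

Proof architecture. FI prove Lemma 3 by induction on `k` from `k = 1`, the prime ideal theorem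
with remainder `x/log x`, via Lemma 2 and a splitting at `√x` (pp. 727–728). Here the induction
starts at `k = 2`, where the statement is Selberg's (elementary) asymptotic formula
`∑_{n ≤ x} Λ₂(n) = 2x log x + O(x)` (`SelbergSymmetryFormula.lean`, after [Apostol1976] Thm 4.18),
and the step `k → k + 1` (`lemma3_step`) is elementary as well: by the recursion
`Λ_{k+1} = Λ_k log + Λ ⋆ Λ_k`,
`S_{k+1}(x) = ∑_{n ≤ x} Λ_k(n) log n + ∑_{d ≤ x} Λ(d) S_k(x/d)`; the first sum is
`S_k(x) log x − ∫_1^x S_k(t) dt/t` (partial summation), the second is handled by the induction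
hypothesis at `x/d` and the weighted Mertens estimate
`∑_{d ≤ x} Λ(d) d⁻¹ (log x/d)^{k−1} = (log x)^k/k + O(6 (log x)^{k−1})`
(`abs_sum_vonMangoldt_div_mul_pow_log_sub_le`, i.e. [FriedlanderIwaniecPisa1978] Lemma 2 for
`K = ℚ` in the form needed, from `∑_{n ≤ x} Λ(n)/n = log x + O(6)` by partial summation and the
integrals `∫_1^x (log x/t)^j dt/t = (log x)^{j+1}/(j+1)`). So no form of the prime number theorem
enters, in accordance with the elementary character of Bombieri's sieve for `k ≥ 2`. All constants
are explicit and crude (`6`, `170`, `e⁶`).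
-/

noncomputable section

open Finset MeasureTheory ArithmeticFunction
open scoped ArithmeticFunction.Moebius ArithmeticFunction.zeta Chebyshev Nat

namespace Literature.NumberTheory.Sieve

namespace BombieriSieve

open SelbergSymmetry

/-! ### Two logarithmic integrals -/

/-- `t ↦ (log x − log t)^j t⁻¹` is continuous on `[1, x]`. [folklore] -/
theorem continuousOn_pow_log_div (j : ℕ) (x : ℝ) :
    ContinuousOn (fun t => (Real.log x - Real.log t) ^ j * t⁻¹) (Set.Icc 1 x) := by
  refine ContinuousOn.mul ((continuousOn_const.sub (Real.continuousOn_log.mono ?_)).pow j)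
    (continuousOn_inv₀.mono ?_)
  · intro t ht
    exact Set.mem_compl_singleton_iff.mpr (by linarith [ht.1] : (0 : ℝ) < t).ne'
  · intro t ht
    exact Set.mem_compl_singleton_iff.mpr (by linarith [ht.1] : (0 : ℝ) < t).ne'

/-- `∫_1^x (log x − log t)^j dt/t = (log x)^{j+1}/(j+1)` (substitute `u = log t`). [folklore] -/
theorem integral_pow_log_div (j : ℕ) {x : ℝ} (hx : 1 ≤ x) :
    ∫ t in Set.Ioc 1 x, (Real.log x - Real.log t) ^ j * t⁻¹ =
      Real.log x ^ (j + 1) / (j + 1) := by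
  have hj : ((j : ℝ) + 1) ≠ 0 := by positivity
  rw [← intervalIntegral.integral_of_le hx]
  have hderiv : ∀ t ∈ Set.uIcc 1 x,
      HasDerivAt (fun t => (Real.log x - Real.log t) ^ (j + 1) / (-((j : ℝ) + 1)))
        ((Real.log x - Real.log t) ^ j * t⁻¹) t := by
    intro t ht
    rw [Set.uIcc_of_le hx] at ht
    have ht0 : t ≠ 0 := (by linarith [ht.1] : (0 : ℝ) < t).ne'
    have h := (((Real.hasDerivAt_log ht0).const_sub (Real.log x)).fun_pow (j + 1)).div_const
      (-((j : ℝ) + 1))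
    refine h.congr_deriv ?_
    rw [Nat.add_sub_cancel]
    push_cast
    field_simp
  rw [intervalIntegral.integral_eq_sub_of_hasDerivAt hderiv
    ((continuousOn_pow_log_div j x).intervalIntegrable_of_Icc hx)]
  simp only [Real.log_one, sub_zero, sub_self, ne_eq, Nat.add_eq_zero_iff, one_ne_zero, and_false,
    not_false_eq_true, zero_pow, zero_div, zero_sub]
  field_simp

/-! ### [FriedlanderIwaniecPisa1978] Lemma 2 for `K = ℚ` in weighted form: Mertens against `(log x/d)^{j+1}` -/

/-- **Weighted Mertens.** For `x ≥ 1` and `j ≥ 0`,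
`|∑_{d ≤ x} Λ(d) d⁻¹ (log x/d)^{j+1} − (log x)^{j+2}/(j+2)| ≤ 6 (log x)^{j+1}`: partial summation
(Mathlib's `sum_mul_eq_sub_integral_mul₀` with `f(t) = (log x − log t)^{j+1}`) turns the sum into
`(j+1) ∫_1^x (log x − log t)^j M(t) dt/t` with `M(t) = ∑_{n ≤ t} Λ(n)/n = log t + O(6)`
(`abs_sum_vonMangoldt_div_sub_log_le`), and `∫_1^x (log x − log t)^j log t dt/t =
(log x)^{j+2}/((j+1)(j+2))`. [folklore] -/
theorem abs_sum_vonMangoldt_div_mul_pow_log_sub_le {x : ℝ} (hx : 1 ≤ x) (j : ℕ) :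
    |∑ d ∈ Ioc 0 ⌊x⌋₊, Λ d / d * Real.log (x / d) ^ (j + 1) -
        Real.log x ^ (j + 2) / (j + 2)| ≤ 6 * Real.log x ^ (j + 1) := by
  set L := Real.log x with hL
  have hx0 : 0 < x := by linarith
  have hL0 : 0 ≤ L := Real.log_nonneg hx
  have hj1 : (0 : ℝ) < (j : ℝ) + 1 := by positivity
  have hj2 : (0 : ℝ) < (j : ℝ) + 2 := by positivity
  -- the coefficients and the weight
  set c : ℕ → ℝ := fun n => Λ n / n with hc
  have hc0 : c 0 = 0 := by simp [hc]
  set f : ℝ → ℝ := fun t => (L - Real.log t) ^ (j + 1) with hf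
  have hderiv : ∀ t ∈ Set.Icc 1 x,
      HasDerivAt f (((j : ℝ) + 1) * (L - Real.log t) ^ j * (-t⁻¹)) t := by
    intro t ht
    have ht0 : t ≠ 0 := (by linarith [ht.1] : (0 : ℝ) < t).ne'
    have h := ((Real.hasDerivAt_log ht0).const_sub L).fun_pow (j + 1)
    refine h.congr_deriv ?_
    rw [Nat.add_sub_cancel]
    push_cast
    ring
  have hdiff : ∀ t ∈ Set.Icc 1 x, DifferentiableAt ℝ f t :=
    fun t ht => (hderiv t ht).differentiableAt
  have hφcont := continuousOn_pow_log_div j x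
  have hderiv_eq : Set.EqOn (fun t => -((j : ℝ) + 1) * ((L - Real.log t) ^ j * t⁻¹)) (deriv f)
      (Set.Icc 1 x) := by
    intro t ht
    rw [(hderiv t ht).deriv]
    ring
  have hint : IntegrableOn (deriv f) (Set.Icc 1 x) := by
    refine IntegrableOn.congr_fun ?_ hderiv_eq measurableSet_Icc
    exact (hφcont.integrableOn_compact isCompact_Icc).const_mul _
  -- Abel summation
  have hAbel := sum_mul_eq_sub_integral_mul₀ c hc0 x hdiff hint
  have hfx : f x = 0 := by simp [hf, hL]
  rw [hfx, zero_mul, zero_sub] at hAbel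
  -- identify the left side
  have hIcc : ∀ m : ℕ, ∑ k ∈ Icc 0 m, c k = ∑ k ∈ Ioc 0 m, c k := fun m => by
    rw [← add_sum_Ioc_eq_sum_Icc (Nat.zero_le _), hc0, zero_add]
  have hleft : ∑ k ∈ Icc 0 ⌊x⌋₊, f k * c k =
      ∑ d ∈ Ioc 0 ⌊x⌋₊, Λ d / d * Real.log (x / d) ^ (j + 1) := by
    rw [← add_sum_Ioc_eq_sum_Icc (Nat.zero_le _), hc0, mul_zero, zero_add]
    refine Finset.sum_congr rfl fun d hd => ?_
    have hd0 : (0 : ℝ) < d := by exact_mod_cast (mem_Ioc.mp hd).1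
    rw [hf, hc, Real.log_div hx0.ne' hd0.ne', mul_comm]
  -- the integral: −∫ f' M = (j+1) ∫ φ M
  set M : ℝ → ℝ := fun t => ∑ k ∈ Icc 0 ⌊t⌋₊, c k with hM
  have hright : ∫ t in Set.Ioc 1 x, deriv f t * M t =
      -((j : ℝ) + 1) * ∫ t in Set.Ioc 1 x, (L - Real.log t) ^ j * t⁻¹ * M t := by
    rw [← integral_const_mul]
    refine setIntegral_congr_fun measurableSet_Ioc fun t ht => ?_
    rw [← hderiv_eq (Set.Ioc_subset_Icc_self ht)]
    ring
  -- Mertens bounds for M on [1, x]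
  have hMb : ∀ t ∈ Set.Ioc 1 x, |M t - Real.log t| ≤ 6 := by
    intro t ht
    rw [hM]
    simp only
    rw [hIcc]
    exact abs_sum_vonMangoldt_div_sub_log_le ht.1.le
  -- integrability of φ M on (1, x]
  have hφM : IntegrableOn (fun t => (L - Real.log t) ^ j * t⁻¹ * M t) (Set.Ioc 1 x) :=
    (integrableOn_mul_sum_Icc c zero_le_one
      (hφcont.integrableOn_compact isCompact_Icc)).mono_set Set.Ioc_subset_Icc_self
  -- comparison functions
  have hcont_up : ContinuousOn (fun t => (L - Real.log t) ^ j * t⁻¹ * (Real.log t + 6))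
      (Set.Icc 1 x) := by
    refine hφcont.mul ((Real.continuousOn_log.mono ?_).add continuousOn_const)
    intro t ht
    exact Set.mem_compl_singleton_iff.mpr (by linarith [ht.1] : (0 : ℝ) < t).ne'
  have hcont_lo : ContinuousOn (fun t => (L - Real.log t) ^ j * t⁻¹ * (Real.log t - 6))
      (Set.Icc 1 x) := by
    refine hφcont.mul ((Real.continuousOn_log.mono ?_).sub continuousOn_const)
    intro t ht
    exact Set.mem_compl_singleton_iff.mpr (by linarith [ht.1] : (0 : ℝ) < t).ne'
  have hφ0 : ∀ t ∈ Set.Ioc 1 x, 0 ≤ (L - Real.log t) ^ j * t⁻¹ := by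
    intro t ht
    have ht0 : 0 < t := by linarith [ht.1]
    have : Real.log t ≤ L := Real.log_le_log ht0 ht.2
    exact mul_nonneg (pow_nonneg (by linarith) j) (inv_nonneg.mpr ht0.le)
  have hup : ∫ t in Set.Ioc 1 x, (L - Real.log t) ^ j * t⁻¹ * M t ≤
      ∫ t in Set.Ioc 1 x, (L - Real.log t) ^ j * t⁻¹ * (Real.log t + 6) := by
    refine setIntegral_mono_on hφM
      ((hcont_up.integrableOn_compact isCompact_Icc).mono_set Set.Ioc_subset_Icc_self)
      measurableSet_Ioc fun t ht => ?_
    have := (abs_le.mp (hMb t ht)).2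
    exact mul_le_mul_of_nonneg_left (by linarith) (hφ0 t ht)
  have hlo : ∫ t in Set.Ioc 1 x, (L - Real.log t) ^ j * t⁻¹ * (Real.log t - 6) ≤
      ∫ t in Set.Ioc 1 x, (L - Real.log t) ^ j * t⁻¹ * M t := by
    refine setIntegral_mono_on
      ((hcont_lo.integrableOn_compact isCompact_Icc).mono_set Set.Ioc_subset_Icc_self) hφM
      measurableSet_Ioc fun t ht => ?_
    have := (abs_le.mp (hMb t ht)).1
    exact mul_le_mul_of_nonneg_left (by linarith) (hφ0 t ht)
  -- evaluate the comparison integrals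
  have hI0 := integral_pow_log_div j hx
  have hI1 := integral_pow_log_div (j + 1) hx
  have hφint : IntegrableOn (fun t => (L - Real.log t) ^ j * t⁻¹) (Set.Ioc 1 x) :=
    (hφcont.integrableOn_compact isCompact_Icc).mono_set Set.Ioc_subset_Icc_self
  have hφint1 : IntegrableOn (fun t => (L - Real.log t) ^ (j + 1) * t⁻¹) (Set.Ioc 1 x) :=
    ((continuousOn_pow_log_div (j + 1) x).integrableOn_compact isCompact_Icc).mono_set
      Set.Ioc_subset_Icc_self
  have heval : ∀ s : ℝ, ∫ t in Set.Ioc 1 x, (L - Real.log t) ^ j * t⁻¹ * (Real.log t + s) =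
      (L + s) * (L ^ (j + 1) / (j + 1)) - L ^ (j + 1 + 1) / ((j + 1 : ℕ) + 1) := by
    intro s
    have hpt : ∀ t : ℝ, (L - Real.log t) ^ j * t⁻¹ * (Real.log t + s) =
        (L + s) * ((L - Real.log t) ^ j * t⁻¹) - (L - Real.log t) ^ (j + 1) * t⁻¹ := by
      intro t
      ring
    simp_rw [hpt]
    rw [integral_sub (hφint.const_mul _) hφint1, integral_const_mul, hI0, hI1]
  have hev_up := heval 6
  have hev_lo := heval (-6)
  simp only [← sub_eq_add_neg] at hev_lo
  push_cast at hev_up hev_lo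
  -- assemble
  rw [← hleft, hAbel, hright]
  have hpow : L ^ (j + 1 + 1) = L ^ (j + 1) * L := pow_succ L (j + 1)
  have hpow2 : L ^ (j + 2) = L ^ (j + 1) * L := pow_succ L (j + 1)
  rw [hpow] at hev_up hev_lo
  rw [hpow2]
  set I := ∫ t in Set.Ioc 1 x, (L - Real.log t) ^ j * t⁻¹ * M t with hI
  set P := L ^ (j + 1) with hP
  have hP0 : 0 ≤ P := pow_nonneg hL0 _
  rw [abs_le]
  constructor
  · -- lower bound from hlo
    rw [hev_lo] at hlo
    have key : P * L / ((j : ℝ) + 2) - 6 * P ≤ -(-((j : ℝ) + 1) * I) := by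
      have h1 : ((j : ℝ) + 1) * ((L - 6) * (P / ((j : ℝ) + 1)) - P * L / ((j : ℝ) + 1 + 1)) ≤
          ((j : ℝ) + 1) * I := mul_le_mul_of_nonneg_left hlo hj1.le
      have h2 : ((j : ℝ) + 1) * ((L - 6) * (P / ((j : ℝ) + 1)) - P * L / ((j : ℝ) + 1 + 1)) =
          P * L / ((j : ℝ) + 2) - 6 * P := by
        field_simp
        ring
      linarith
    linarith
  · rw [hev_up] at hup
    have key : -(-((j : ℝ) + 1) * I) ≤ P * L / ((j : ℝ) + 2) + 6 * P := by
      have h1 : ((j : ℝ) + 1) * I ≤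
          ((j : ℝ) + 1) * ((L + 6) * (P / ((j : ℝ) + 1)) - P * L / ((j : ℝ) + 1 + 1)) :=
        mul_le_mul_of_nonneg_left hup hj1.le
      have h2 : ((j : ℝ) + 1) * ((L + 6) * (P / ((j : ℝ) + 1)) - P * L / ((j : ℝ) + 1 + 1)) =
          P * L / ((j : ℝ) + 2) + 6 * P := by
        field_simp
        ring
      linarith
    linarith

/-! ### The induction step `k → k + 1` and Lemma 3 -/

/-- **The induction step of [FriedlanderIwaniecPisa1978] Lemma 3 (scalar case, `K = ℚ`),
elementary version.** Write `k = j + 2 ≥ 2`. If `|S_k(y) − k y (log y)^{k−1}| ≤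
c^k y (log cy)^{k−2}` for all `y ≥ 1`, with `c ≥ 9` and `log c ≥ 4`, then the same holds for
`k + 1`. Proof: `S_{k+1}(x) = ∑_{n ≤ x} Λ_k(n) log n + ∑_{d ≤ x} Λ(d) S_k(x/d)`
(`generalizedVonMangoldt_succ`); the first sum is `S_k(x) log x − ∫_1^x S_k(t) dt/t` with
`0 ≤ ∫ ≤ (k (log x)^{k−1} + c^k (log cx)^{k−2}) x` (partial summation and the hypothesis); in the
second, the hypothesis at `x/d` and Mertens' `∑_{d ≤ x} Λ(d)/d ≤ log x + 6` bound the error by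
`c^k x (log cx)^{k−2} (log x + 6)`, while the main term `k x ∑_{d ≤ x} Λ(d) d⁻¹ (log x/d)^{k−1} =
x (log x)^k + O(6k x (log x)^{k−1})` is the weighted Mertens estimate
`abs_sum_vonMangoldt_div_mul_pow_log_sub_le`. The total error
`c^k x (log cx)^{k−2}(2 log x + 7) + 7k x (log x)^{k−1} ≤ 9 c^k x (log cx)^{k−1} ≤
c^{k+1} x (log cx)^{k−1}`. (FI start the induction at `k = 1` from the prime ideal theorem; here
it starts at `k = 2` from Selberg's formula, so no form of the prime number theorem is used.)
[cite: FriedlanderIwaniecPisa1978, Lemma 3 (proof, pp. 727–728)] -/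
theorem lemma3_step (j : ℕ) {c : ℝ} (hc9 : 9 ≤ c) (hlogc : 4 ≤ Real.log c)
    (ih : ∀ y : ℝ, 1 ≤ y →
      |∑ m ∈ Ioc 0 ⌊y⌋₊, generalizedVonMangoldt (j + 2) m - (j + 2) * y * Real.log y ^ (j + 1)| ≤
        c ^ (j + 2) * y * Real.log (c * y) ^ j)
    {x : ℝ} (hx : 1 ≤ x) :
    |∑ m ∈ Ioc 0 ⌊x⌋₊, generalizedVonMangoldt (j + 2 + 1) m -
        (j + 2 + 1) * x * Real.log x ^ (j + 2)| ≤
      c ^ (j + 2 + 1) * x * Real.log (c * x) ^ (j + 1) := by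
  obtain ⟨S, hS⟩ : ∃ S : ℝ → ℝ,
      S = fun y => ∑ m ∈ Ioc 0 ⌊y⌋₊, generalizedVonMangoldt (j + 2) m := ⟨_, rfl⟩
  have hSy : ∀ y, S y = ∑ m ∈ Ioc 0 ⌊y⌋₊, generalizedVonMangoldt (j + 2) m := fun y => by
    rw [hS]
  have ih' : ∀ y : ℝ, 1 ≤ y →
      |S y - (j + 2) * y * Real.log y ^ (j + 1)| ≤ c ^ (j + 2) * y * Real.log (c * y) ^ j := by
    intro y hy
    rw [hSy]
    exact ih y hy
  have hS0 : ∀ y, 0 ≤ S y := fun y => by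
    rw [hSy]
    exact Finset.sum_nonneg fun m _ => generalizedVonMangoldt_nonneg _ _
  have hx0 : 0 < x := by linarith
  have hc0 : 0 < c := by linarith
  have hL0 : 0 ≤ Real.log x := Real.log_nonneg hx
  have hℓeq : Real.log (c * x) = Real.log c + Real.log x := Real.log_mul hc0.ne' hx0.ne'
  have hLℓ : Real.log x ≤ Real.log (c * x) := by linarith
  have hℓ0 : 0 ≤ Real.log (c * x) := by linarith
  have hP0 : 0 < c ^ (j + 2) := pow_pos hc0 _
  have hQ0 : 0 ≤ Real.log (c * x) ^ j := pow_nonneg hℓ0 _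
  have hR0 : 0 ≤ Real.log x ^ (j + 1) := pow_nonneg hL0 _
  -- the decomposition `S_{k+1}(x) = ∑ Λ_k(n) log n + ∑_d Λ(d) S_k(x/d)`
  have hdecomp : ∑ m ∈ Ioc 0 ⌊x⌋₊, generalizedVonMangoldt (j + 2 + 1) m =
      ∑ m ∈ Ioc 0 ⌊x⌋₊, generalizedVonMangoldt (j + 2) m * Real.log m +
        ∑ d ∈ Ioc 0 ⌊x⌋₊, Λ d * S (x / d) := by
    have h1 : ∀ m : ℕ, generalizedVonMangoldt (j + 2 + 1) m =
        generalizedVonMangoldt (j + 2) m * Real.log m +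
          (Λ * generalizedVonMangoldt (j + 2)) m := by
      intro m
      rw [generalizedVonMangoldt_succ, ArithmeticFunction.add_apply, pmul_apply, log_apply]
    rw [Finset.sum_congr rfl fun m _ => h1 m, Finset.sum_add_distrib, sum_Ioc_mul_eq_sum_sum]
    congr 1
    refine Finset.sum_congr rfl fun d _ => ?_
    rw [hSy, Nat.floor_div_natCast]
  -- (i) `∑ Λ_k(n) log n = S_k(x) log x − I`, `0 ≤ I ≤ K (x − 1)`
  have hA : ∑ m ∈ Ioc 0 ⌊x⌋₊, generalizedVonMangoldt (j + 2) m * Real.log m =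
      S x * Real.log x - ∫ t in Set.Ioc 1 x, S t / t := by
    rw [sum_mul_log_eq (fun n => generalizedVonMangoldt (j + 2) n) (by simp) x, hSy]
    congr 1
    refine setIntegral_congr_fun measurableSet_Ioc fun t _ => ?_
    rw [hSy]
  have hK : ∀ t ∈ Set.Ioc 1 x,
      S t ≤ ((j + 2) * Real.log x ^ (j + 1) + c ^ (j + 2) * Real.log (c * x) ^ j) * t := by
    intro t ht
    have ht1 : 1 ≤ t := ht.1.le
    have ht0 : 0 < t := by linarith [ht.1]
    have h := (abs_le.mp (ih' t ht1)).2
    have hlt : Real.log t ≤ Real.log x := Real.log_le_log ht0 ht.2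
    have hlt0 : 0 ≤ Real.log t := Real.log_nonneg ht1
    have hct1 : 1 ≤ c * t := by nlinarith
    have hlct : Real.log (c * t) ≤ Real.log (c * x) :=
      Real.log_le_log (by positivity) (mul_le_mul_of_nonneg_left ht.2 hc0.le)
    have hlct0 : 0 ≤ Real.log (c * t) := Real.log_nonneg hct1
    have e1 : Real.log t ^ (j + 1) ≤ Real.log x ^ (j + 1) := pow_le_pow_left₀ hlt0 hlt _
    have e2 : Real.log (c * t) ^ j ≤ Real.log (c * x) ^ j := pow_le_pow_left₀ hlct0 hlct _
    have e3 : (j + 2 : ℝ) * t * Real.log t ^ (j + 1) ≤ (j + 2) * t * Real.log x ^ (j + 1) :=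
      mul_le_mul_of_nonneg_left e1 (by positivity)
    have e4 : c ^ (j + 2) * t * Real.log (c * t) ^ j ≤ c ^ (j + 2) * t * Real.log (c * x) ^ j :=
      mul_le_mul_of_nonneg_left e2 (by positivity)
    nlinarith
  have hI := setIntegral_div_bounds (C := S) hx (fun t _ => hS0 t) hK
  -- (ii) `∑_d Λ(d) S_k(x/d) = k x ∑_d Λ(d) d⁻¹ (log x/d)^{k−1} + O(c^k x (log cx)^{k−2} (log x + 6))`
  have hE : |∑ d ∈ Ioc 0 ⌊x⌋₊, Λ d * S (x / d) -
      (j + 2) * x * ∑ d ∈ Ioc 0 ⌊x⌋₊, Λ d / d * Real.log (x / d) ^ (j + 1)| ≤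
      c ^ (j + 2) * x * Real.log (c * x) ^ j * (Real.log x + 6) := by
    have hM := (abs_le.mp (abs_sum_vonMangoldt_div_sub_log_le hx)).2
    rw [Finset.mul_sum, ← Finset.sum_sub_distrib]
    refine (Finset.abs_sum_le_sum_abs _ _).trans ?_
    have hterm : ∀ d ∈ Ioc 0 ⌊x⌋₊,
        |Λ d * S (x / d) - (j + 2) * x * (Λ d / d * Real.log (x / d) ^ (j + 1))| ≤
          c ^ (j + 2) * x * Real.log (c * x) ^ j * (Λ d / d) := by
      intro d hd
      obtain ⟨hd0, hdN⟩ := mem_Ioc.mp hd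
      have hd0' : (0 : ℝ) < d := by exact_mod_cast hd0
      have h1d : (1 : ℝ) ≤ d := by exact_mod_cast hd0
      have hdx : (d : ℝ) ≤ x := le_trans (by exact_mod_cast hdN) (Nat.floor_le hx0.le)
      have hy : 1 ≤ x / d := by rwa [le_div_iff₀ hd0', one_mul]
      have h := ih' (x / d) hy
      have hΛ : 0 ≤ Λ d := vonMangoldt_nonneg
      have hcxd : Real.log (c * (x / d)) ≤ Real.log (c * x) := by
        apply Real.log_le_log (by positivity)
        rw [mul_div_assoc']
        exact div_le_self (by positivity) h1d
      have hcxd0 : 0 ≤ Real.log (c * (x / d)) := Real.log_nonneg (by nlinarith)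
      have e2 : Real.log (c * (x / d)) ^ j ≤ Real.log (c * x) ^ j := pow_le_pow_left₀ hcxd0 hcxd _
      have heq : Λ d * S (x / d) - (j + 2) * x * (Λ d / d * Real.log (x / d) ^ (j + 1)) =
          Λ d * (S (x / d) - (j + 2) * (x / d) * Real.log (x / d) ^ (j + 1)) := by
        ring
      rw [heq, abs_mul, abs_of_nonneg hΛ]
      calc Λ d * |S (x / d) - (j + 2) * (x / d) * Real.log (x / d) ^ (j + 1)|
          ≤ Λ d * (c ^ (j + 2) * (x / d) * Real.log (c * (x / d)) ^ j) :=
            mul_le_mul_of_nonneg_left h hΛ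
        _ ≤ Λ d * (c ^ (j + 2) * (x / d) * Real.log (c * x) ^ j) := by
            apply mul_le_mul_of_nonneg_left _ hΛ
            exact mul_le_mul_of_nonneg_left e2 (by positivity)
        _ = c ^ (j + 2) * x * Real.log (c * x) ^ j * (Λ d / d) := by
            field_simp
    refine (Finset.sum_le_sum hterm).trans ?_
    rw [← Finset.mul_sum]
    have hM' : ∑ d ∈ Ioc 0 ⌊x⌋₊, Λ d / d ≤ Real.log x + 6 := by linarith
    exact mul_le_mul_of_nonneg_left hM' (by positivity)
  have hSig := abs_sum_vonMangoldt_div_mul_pow_log_sub_le hx j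
  -- (iii) assembly
  have hSx := ih' x hx
  rw [hdecomp, hA]
  obtain ⟨hI0, hI1⟩ := hI
  obtain ⟨hAx1, hAx2⟩ := abs_le.mp hSx
  obtain ⟨hEx1, hEx2⟩ := abs_le.mp hE
  obtain ⟨hSgx1, hSgx2⟩ := abs_le.mp hSig
  set I := ∫ t in Set.Ioc 1 x, S t / t with hIdef
  set Bs := ∑ d ∈ Ioc 0 ⌊x⌋₊, Λ d * S (x / d) with hBs
  set Sg := ∑ d ∈ Ioc 0 ⌊x⌋₊, Λ d / d * Real.log (x / d) ^ (j + 1) with hSg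
  set L := Real.log x with hL
  set ℓ := Real.log (c * x) with hℓ
  set P := c ^ (j + 2) with hP
  set Q := ℓ ^ j with hQ
  set R := L ^ (j + 1) with hR
  -- products of the two-sided bounds with nonnegative factors
  have ha1 : (S x - (j + 2) * x * R) * L ≤ P * x * Q * L :=
    mul_le_mul_of_nonneg_right hAx2 hL0
  have ha2 : -(P * x * Q) * L ≤ (S x - (j + 2) * x * R) * L :=
    mul_le_mul_of_nonneg_right hAx1 hL0
  have hjx : 0 ≤ (j + 2 : ℝ) * x := by positivity
  have hd1 : (j + 2 : ℝ) * x * (Sg - L ^ (j + 2) / (j + 2)) ≤ (j + 2) * x * (6 * R) :=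
    mul_le_mul_of_nonneg_left hSgx2 hjx
  have hd2 : (j + 2 : ℝ) * x * (-(6 * R)) ≤ (j + 2) * x * (Sg - L ^ (j + 2) / (j + 2)) :=
    mul_le_mul_of_nonneg_left hSgx1 hjx
  have hj2 : (0 : ℝ) < (j : ℝ) + 2 := by positivity
  have hLR : L ^ (j + 2) = R * L := by rw [hR, pow_succ]
  have hsplit : (j + 2 : ℝ) * x * (L ^ (j + 2) / (j + 2)) = x * R * L := by
    rw [hLR]
    calc (j + 2 : ℝ) * x * (R * L / (j + 2)) = x * R * L * ((j + 2) / (j + 2)) := by ring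
      _ = x * R * L := by rw [div_self hj2.ne', mul_one]
  have hd1' : (j + 2 : ℝ) * x * Sg - x * R * L ≤ 6 * ((j + 2) * x * R) := by
    have := hd1
    rw [mul_sub, hsplit] at this
    linarith
  have hd2' : -(6 * ((j + 2 : ℝ) * x * R)) ≤ (j + 2) * x * Sg - x * R * L := by
    have := hd2
    rw [mul_sub, hsplit] at this
    linarith
  have hmain : (j + 2 + 1 : ℝ) * x * L ^ (j + 2) = (j + 2) * x * R * L + x * R * L := by
    rw [hLR]
    ring
  -- the final comparison `P x Q (2L + 7) + 7 (j+2) x R ≤ c P x ℓ^{j+1}`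
  have h1 : 2 * L + 7 ≤ 2 * ℓ := by linarith
  have hk_le : (j + 2 : ℝ) ≤ P := by
    have h2 : (j + 2 : ℝ) ≤ 2 ^ (j + 2) := by
      have := Nat.lt_two_pow_self (n := j + 2)
      exact_mod_cast this.le
    exact h2.trans (pow_le_pow_left₀ (by norm_num) (by linarith) _)
  have hRℓ : R ≤ ℓ ^ (j + 1) := pow_le_pow_left₀ hL0 hLℓ _
  have hPxQ : 0 ≤ P * x * Q := by positivity
  have hjxR : 0 ≤ (j + 2 : ℝ) * x * R := by positivity
  have hfin1 : P * x * Q * (2 * L + 7) ≤ P * x * Q * (2 * ℓ) :=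
    mul_le_mul_of_nonneg_left h1 hPxQ
  have hQℓ : P * x * Q * (2 * ℓ) = 2 * (P * x * ℓ ^ (j + 1)) := by
    rw [hQ, pow_succ]
    ring
  have hfin2 : 7 * ((j + 2 : ℝ) * x * R) ≤ 7 * (P * x * ℓ ^ (j + 1)) := by
    have : (j + 2 : ℝ) * x * R ≤ P * x * ℓ ^ (j + 1) :=
      mul_le_mul (mul_le_mul_of_nonneg_right hk_le hx0.le) hRℓ hR0 (by positivity)
    linarith
  have hfin3 : 9 * (P * x * ℓ ^ (j + 1)) ≤ c * (P * x * ℓ ^ (j + 1)) :=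
    mul_le_mul_of_nonneg_right hc9 (by positivity)
  have hcpow : c ^ (j + 2 + 1) * x * ℓ ^ (j + 1) = c * (P * x * ℓ ^ (j + 1)) := by
    rw [hP, pow_succ]
    ring
  have hKnn : 0 ≤ (j + 2 : ℝ) * R + P * Q := by positivity
  have hKx : ((j + 2 : ℝ) * R + P * Q) * (x - 1) =
      ((j + 2) * R + P * Q) * x - ((j + 2) * R + P * Q) := by ring
  have hI1' : I ≤ ((j + 2 : ℝ) * R + P * Q) * x := by linarith
  rw [hmain, hcpow, abs_le]
  constructor
  · linarith
  · linarith

/-- **[FriedlanderIwaniecPisa1978] Lemma 3 for `K = ℚ`, scalar `k ≥ 2`, with an explicit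
constant** (the statement vendored as the named fact `Literature.NumberTheory.Sieve.FI1978_lemma3_rat` in
`BombieriAsymptoticSieve.lean`): with `c = e⁶`, for all `k ≥ 2` and `x ≥ 1`,
`|∑_{m ≤ x} Λ_k(m) − k x (log x)^{k−1}| ≤ c^k x (log cx)^{k−2}`. Induction on `k`: the base
`k = 2` is Selberg's formula `|∑_{n ≤ x} Λ₂(n) − 2x log x| ≤ 170 x`
(`SelbergSymmetry.abs_sum_generalizedVonMangoldt_two_sub_le`), the step is `lemma3_step`.
[cite: FriedlanderIwaniecPisa1978, Lemma 3 (K = Q, scalar k ≥ 2)] -/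
theorem FI1978_lemma3_rat_explicit : ∃ c : ℝ, 1 ≤ c ∧ ∀ k : ℕ, 2 ≤ k → ∀ x : ℝ, 1 ≤ x →
    |(∑ m ∈ Ioc 0 ⌊x⌋₊, generalizedVonMangoldt k m) - k * x * Real.log x ^ (k - 1)| ≤
      c ^ k * x * Real.log (c * x) ^ (k - 2) := by
  have he : (387 : ℝ) ≤ Real.exp 6 := by
    have h1 := Real.exp_one_gt_d9
    have h2 : Real.exp 6 = Real.exp 1 ^ 6 := by
      rw [← Real.exp_nat_mul]
      norm_num
    rw [h2]
    have h3 : (2.7182818283 : ℝ) ^ 6 ≤ Real.exp 1 ^ 6 :=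
      pow_le_pow_left₀ (by norm_num) h1.le 6
    nlinarith
  have hlog : Real.log (Real.exp 6) = 6 := Real.log_exp 6
  refine ⟨Real.exp 6, by linarith, ?_⟩
  intro k hk
  induction k, hk using Nat.le_induction with
  | base =>
    intro x hx
    have h := abs_sum_generalizedVonMangoldt_two_sub_le hx
    have hx0 : 0 < x := by linarith
    norm_num
    have h2 : (170 : ℝ) ≤ Real.exp 6 ^ 2 := by nlinarith
    calc |∑ m ∈ Ioc 0 ⌊x⌋₊, generalizedVonMangoldt 2 m - 2 * x * Real.log x| ≤ 170 * x := h
      _ ≤ Real.exp 6 ^ 2 * x := by nlinarith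
  | succ k hk ihk =>
    obtain ⟨j, rfl⟩ : ∃ j, k = j + 2 := ⟨k - 2, by omega⟩
    have e1 : j + 2 - 1 = j + 1 := by omega
    have e2 : j + 2 - 2 = j := by omega
    have e3 : j + 2 + 1 - 1 = j + 2 := by omega
    have e4 : j + 2 + 1 - 2 = j + 1 := by omega
    intro x hx
    rw [e3, e4]
    have ih' : ∀ y : ℝ, 1 ≤ y →
        |∑ m ∈ Ioc 0 ⌊y⌋₊, generalizedVonMangoldt (j + 2) m - (j + 2) * y * Real.log y ^ (j + 1)| ≤
          Real.exp 6 ^ (j + 2) * y * Real.log (Real.exp 6 * y) ^ j := by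
      intro y hy
      have := ihk y hy
      rw [e1, e2] at this
      push_cast at this
      exact this
    have := lemma3_step j (by linarith) (by rw [hlog]; norm_num) ih' hx
    push_cast
    exact this

end BombieriSieve

end Literature.NumberTheory.Sieve
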